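import Literature.NumberTheory.LFunctions.LargeValuesS3Bound
import HarnessLib

/-!
# Guth–Maynard Lemma 1.7 and Proposition 8.1, as printed — NOT RH-BEARING: a density / large-values theorem counts zeros off the line, it never empties the strip (Barrier LindelofBacklund)

NOT RH-BEARING (D-0040): a large-values / zero-density statement COUNTS large values of a Dirichlet
polynomial or zeros off the critical line, it never empties the strip
(`Literature.Barriers.RiemannHypothesis.LindelofBacklund`); nothing in this file bears on the truth of
the Riemann Hypothesis, and nothing here is progress toward it. Cell rh-crit, corpus C4
(Guth–Maynard), work package WP-B1; bears_on LADDER-RH §4 HELD row `DensityLadder`.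

Topic `NumberTheory/LFunctions`, family RH. Source: L. Guth, J. Maynard, *New large value estimates
for Dirichlet polynomials*, Ann. of Math. (2) 203 (2026), 623–675 = arXiv:2405.20552. The analytic
content of §§3–13.1 of the paper is PROVED in the tree (`zeroDensity_guth_maynard_holds` = Theorem 1.2;
the chain `LargeValues*.lean`, `EnergyThirdMoment.lean`, `DiscreteMomentsR.lean`,
`LargeValuesEnergyBound.lean`), but two printed statements have no standalone declaration there:

* **Lemma 1.7** (§1.1; restated at the head of §11): for `N ∈ [T^{2/3}, T]`, `σ > 1/2`,
  `D(t) = ∑_{N<n≤2N} b_n n^{it}` with `|b_n| ≤ 1` and a `1`-separated `W ⊂ [0,T]` with `|D(t)| > N^σ`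
  on `W`, `E(W) ≤ |W|³N^{1−2σ+o(1)} + |W|²N^{2−2σ+o(1)}`, where
  `E(W) := #{(w₁,w₂,w₃,w₄) ∈ W⁴ : |w₁+w₂−w₃−w₄| ≤ 1}` is the additive energy (the display of §1.1
  before Lemma 1.7; the tree's `GuthMaynardAssembly.addEnergy`). Stated here as
  `GuthMaynard2026_lemma_1_7` and PROVED (`GuthMaynard2026_lemma_1_7_holds`) along the printed proof
  (§11, "Proof of Lemma 1.7"): Lemma 11.4 (`GuthMaynardEnergy.energy_le_third_moment_abs`), the
  trivial bound `|R(x)| ≤ |W|` (`GuthMaynardRFunction.norm_Rfun_le`), Lemma 11.5 = Heath-Brown's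
  Theorem 1.6 (`GuthMaynardDiscreteMoments.discrete_second_moment`, from
  `HeathBrownDZS.heathBrown_differenceSet`), and the footnote to Theorem 1.6: for `N ≥ T^{2/3}`,
  `|W|^{5/4}T^{1/2}N ≤ |W|^{5/4}N^{7/4} = (|W|²N)^{1/4}(|W|N²)^{3/4} ≤ |W|²N + |W|N²`.
* **Proposition 8.1** (§8, "`S₃` controlled by energy"): if `W` is a `T^ε`-separated set contained in
  an interval of length `T`, then `S₃ ⪅_ε T²|W|^{1/2}E(W)^{1/2}`, `S₃` being the piece of the expansion of
  the cubic trace `tr((M_W M_W^*)³)` with all three `m_i ≠ 0` (eq. (5.5); the tree's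
  `GuthMaynardFourier.S3 w N W`). It is off the final proof path (superseded by Proposition 10.1,
  `GuthMaynardS3Final.S3_bound`, "a strengthening of this proposition"). Stated here as
  `GuthMaynard2026_proposition_8_1` in the standing regime of §§4–12 (the proof of Proposition 3.1:
  the weight `w` of §3, `T = N^{6/5}`, `W` in an interval of length `T`, `T^ε`-separated — the exact
  binder shape of the tree's Proposition 10.1) and PROVED (`GuthMaynard2026_proposition_8_1_holds`) by
  the comparison the Remark after Proposition 10.1 makes: Proposition 10.1 gives
  `S₃ ⪅ T²|W|^{3/2} + TN|W|^{1/2}E(W)^{1/2}`, and `|W|² ≤ E(W)` (`GuthMaynardEnergyBound.card_sq_le_energy`),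
  `N ≤ T`. The printed §8 proof (Proposition 7.2, Hölder, Lemmas 8.2 and 8.3 — all proved in the tree)
  is not reproduced here.

Conventions of the paper (§1.2): `A ⪅ B` means `∀ ε > 0 ∃ C(ε): |A| ≤ C(ε) T^ε B` for all large `T`
(the `ε`-power is a power of `T`); `o(1)` is as `T → ∞`; `n ∼ N` means `N < n ≤ 2N`. Rendering used
below: `N^{x+o(1)}` ↦ `∀ ε > 0, ∃ C T₀, ∀ T ≥ T₀, … ≤ C · N^{x+ε}` (for `N ≥ T^{2/3}` the powers
`N^{o(1)}` and `T^{o(1)}` are interchangeable); `⪅_ε` ↦ `∀ δ > 0, ∃ C N₀, ∀ N ≥ N₀, … ≤ C N^δ (…)`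
in the regime `T = N^{6/5}` of Proposition 3.1 (where `T^δ = N^{6δ/5}`).

Design choices recorded for the referee. (1) Lemma 1.7 keeps the printed half-open range
`N < n ≤ 2N` (`Finset.Ioc N (2N)`; Theorem 1.1 prints the closed `∑_{n=N}^{2N}`), the strict
`|D(t)| > N^σ`, `σ > 1/2` with no upper restriction, and `N ∈ [T^{2/3},T]`; the constant is uniform in
`σ, b, W, N, T` (as the printed proof gives). (2) Proposition 8.1 is printed inside the proof of
Proposition 3.1 (§4 opens "we begin to work on the proof of Proposition 3.1"), whose setting fixes the
weight `w` of §3 and has `T = N^{6/5}` with `W` in an interval of length `T`; like the tree's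
Propositions 6.1, 10.1, 11.1 (form "specialised" in the cell's CONCORDANCE) it is typed in that
regime, for every admissible weight `w` (smooth, supported in `[1,2]`, `= 1` on `[6/5,9/5]`, values in
`[0,1]`), with `⪅_ε` ↦ `∀ δ > 0 ∃ C N₀ ∀ N ≥ N₀: … ≤ C N^δ (…)` (`N`- and `T`-powers are interchangeable
for `T = N^{6/5}`). TODO(general form): the display of §8 read with `T` a free parameter — for
`1 ≤ N ≤ T`, `W ⊂ [t₀, t₀+T]` `T^ε`-separated, `‖S₃‖ ≤ C(w,ε,δ) T^δ · T²|W|^{1/2}E(W)^{1/2}` for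
`T ≥ T₀(w,ε,δ)` — is not stated as a named fact here (it is implied, in the same way, by a free-`T`
Proposition 10.1, which the tree does not yet have; cf. eq. (12.1) with `T` free in §12).
No conjecture is stated here (Conjecture 1.5 stays `MontgomeryLargeValueConjecture`,
`@[conjecture]`); nothing of the tree is restated.

## References

* L. Guth, J. Maynard, *New large value estimates for Dirichlet polynomials*, Ann. of Math. (2) 203
  (2026), no. 2, 623–675; arXiv:2405.20552 (2024): §1.1 (definition of `E(W)`, Lemma 1.7 and the Remark
  after it, footnote to Theorem 1.6), §1.2 (conventions), §8 Proposition 8.1, §11 Lemmas 11.4, 11.5 and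
  "Proof of Lemma 1.7". [key `GuthMaynard2026`; locators read from the materialised corpus-tex
  `paper:arxiv-2405.20552` (= arXiv v1), chunks p0004:L40–L69, p0005, p0016:L1–L9, p0022:L9–L16,
  p0023:L33–L48; page numbers "arXiv v2 p. n" are those of arXiv v2 (2026-04-07, post-referee), where
  these statements read identically (cell sheet gm/LIT-LOCATORS-gm.md): E(W) = eq. (1.7) and Lemma 1.7
  p. 5, Theorem 1.6 + footnote p. 4, Proposition 8.1 p. 25, Proposition 10.1 + Remark p. 36,
  Lemma 11.4 p. 39, Lemma 11.5 and the proof of Lemma 1.7 p. 40]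
* D. R. Heath-Brown, *A large values estimate for Dirichlet polynomials*, J. London Math. Soc. (2) 20
  (1979), 8–18 (Theorem 1.6 of the paper; in the tree `HeathBrownDZS.heathBrown_differenceSet`).
-/

noncomputable section

open Real Complex Finset
open scoped ContDiff

namespace Literature.NumberTheory.LFunctions

open GuthMaynardRFunction GuthMaynardEnergy GuthMaynardDiscreteMoments GuthMaynardAssembly
  GuthMaynardFourier

/-! ## §1. Lemma 1.7 as printed -/

/-- **Guth–Maynard Lemma 1.7 (as printed).** Let `N ∈ [T^{2/3}, T]`, `σ > 1/2` and
`D(t) = ∑_{N<n≤2N} b_n n^{it}` with `|b_n| ≤ 1`. Suppose `W ⊂ [0,T]` is a `1`-separated set such that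
`|D(t)| > N^σ` for `t ∈ W`. Then `E(W) ≤ |W|³N^{1−2σ+o(1)} + |W|²N^{2−2σ+o(1)}`, where
`E(W) = #{(w₁,w₂,w₃,w₄) ∈ W⁴ : |w₁+w₂−w₃−w₄| ≤ 1}` is `GuthMaynardAssembly.addEnergy W`. The `o(1)`
(as `T → ∞`, §1.2 of the paper) is rendered as: for every `ε > 0` there are `C, T₀` such that for all
`T ≥ T₀` the bound holds with exponents `1−2σ+ε`, `2−2σ+ε` and the factor `C`, uniformly in
`N, σ, b, W`. (Remark after Lemma 1.7: the `ℓ^∞` hypothesis `|b_n| ≤ 1` is essential to the proof.)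
PROVED below: `GuthMaynard2026_lemma_1_7_holds`.
[cite: GuthMaynard2026, Lemma 1.7 (arXiv v2 p. 5; restated §11 p. 38; energy display (1.7) p. 5)] -/
def GuthMaynard2026_lemma_1_7 : Prop :=
  ∀ ε : ℝ, 0 < ε → ∃ C T₀ : ℝ, ∀ T : ℝ, T₀ ≤ T → ∀ N : ℕ, T ^ (2 / 3 : ℝ) ≤ (N : ℝ) → (N : ℝ) ≤ T →
    ∀ σ : ℝ, 1 / 2 < σ → ∀ (b : ℕ → ℂ) (W : Finset ℝ), (∀ n, ‖b n‖ ≤ 1) →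
    (∀ t ∈ W, 0 ≤ t ∧ t ≤ T) → (∀ t ∈ W, ∀ t' ∈ W, t ≠ t' → 1 ≤ |t - t'|) →
    (∀ t ∈ W, (N : ℝ) ^ σ < ‖∑ n ∈ Finset.Ioc N (2 * N), b n * (n : ℂ) ^ ((t : ℂ) * I)‖) →
    GuthMaynardAssembly.addEnergy W ≤
      C * ((W.card : ℝ) ^ 3 * (N : ℝ) ^ (1 - 2 * σ + ε) +
        (W.card : ℝ) ^ 2 * (N : ℝ) ^ (2 - 2 * σ + ε))

/-! ## §2. Proposition 8.1 (in the standing regime of Proposition 3.1), stated and proved -/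

/-- **Guth–Maynard Proposition 8.1 (`S₃` controlled by energy).** Printed: "If `W` is a
`T^ε`-separated set contained in an interval of length `T`, then `S₃ ⪅_ε T² |W|^{1/2} E(W)^{1/2}`."
Here `S₃ = GuthMaynardFourier.S3 w N W` is the all-`m_i ≠ 0` piece of the expansion of
`tr((M_W M_W^*)³)` (Lemma 4.5 and eq. (5.5)) for the weight `w` fixed in §3 of the paper (smooth,
supported in `[1,2]`, `w = 1` on `[6/5, 9/5]`; here any such `w` with values in `[0,1]`, the constant
depending on `w`), and `E(W) = GuthMaynardAssembly.addEnergy W`. Typed in the standing regime of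
§§4–12 of the paper, the proof of Proposition 3.1 (`T = N^{6/5}`, `W ⊂ [t₀, t₀ + T]`
`T^ε`-separated), in exactly the binder shape of the tree's Proposition 10.1
`GuthMaynardS3Final.S3_bound`, with `⪅_ε` (§1.2) rendered as `∀ δ > 0 ∃ C N₀ ∀ N ≥ N₀:
‖S₃‖ ≤ C N^δ · T²|W|^{1/2}E(W)^{1/2}`, `C = C(w, ε, δ)`. (TODO(general form): `T` a free parameter
with `1 ≤ N ≤ T` — see the module docstring; not a named fact here.) PROVED below
(`GuthMaynard2026_proposition_8_1_holds`). [cite: GuthMaynard2026, Proposition 8.1 (arXiv v2 p. 25)] -/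
def GuthMaynard2026_proposition_8_1 : Prop :=
  ∀ (w : ℝ → ℝ), ContDiff ℝ ∞ w → Function.support w ⊆ Set.Icc 1 2 →
    (∀ u : ℝ, 6 / 5 ≤ u → u ≤ 9 / 5 → w u = 1) → (∀ u : ℝ, 0 ≤ w u ∧ w u ≤ 1) →
    ∀ ε : ℝ, 0 < ε → ∀ δ : ℝ, 0 < δ → ∃ C N₀ : ℝ, ∀ N : ℕ, N₀ ≤ (N : ℝ) →
    ∀ (t₀ : ℝ) (W : Finset ℝ), (∀ t ∈ W, t₀ ≤ t ∧ t ≤ t₀ + (N : ℝ) ^ (6 / 5 : ℝ)) →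
    (∀ t ∈ W, ∀ t' ∈ W, t ≠ t' → ((N : ℝ) ^ (6 / 5 : ℝ)) ^ ε ≤ |t - t'|) →
    ‖GuthMaynardFourier.S3 w N W‖ ≤ C * (N : ℝ) ^ δ *
      (((N : ℝ) ^ (6 / 5 : ℝ)) ^ 2 * (W.card : ℝ) ^ (1 / 2 : ℝ) *
        (GuthMaynardAssembly.addEnergy W) ^ (1 / 2 : ℝ))

/-- **Guth–Maynard Proposition 8.1, proved** (discharge of `GuthMaynard2026_proposition_8_1`) from the
tree's Proposition 10.1 (`GuthMaynardS3Final.S3_bound`: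
`‖S₃‖ ≤ C N^δ (T²|W|^{3/2} + TN|W|^{1/2}E(W)^{1/2})`, `T = N^{6/5}`) by the comparison of the Remark
after Proposition 10.1: `T²|W|^{3/2} ≤ T²|W|^{1/2}E(W)^{1/2}` because `|W|² ≤ E(W)`
(`GuthMaynardEnergyBound.card_sq_le_energy`), and `TN ≤ T²` because `N ≤ N^{6/5} = T`. This is not
the printed §8 proof (Proposition 7.2, Hölder, Lemmas 8.2, 8.3), which is not reproduced.
[cite: GuthMaynard2026, Proposition 8.1 (arXiv v2 p. 25) and Remark after Proposition 10.1 (p. 36)] -/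
theorem GuthMaynard2026_proposition_8_1_holds : GuthMaynard2026_proposition_8_1 := by
  intro w hw hsupp hw1 hw01 ε hε δ hδ
  obtain ⟨C, N₀, hC⟩ := GuthMaynardS3Final.S3_bound w hw hsupp hw1 hw01 ε hε δ hδ
  refine ⟨2 * |C|, max N₀ 1, fun N hN t₀ W hW hsep ↦ ?_⟩
  have hN₀ : N₀ ≤ (N : ℝ) := (le_max_left _ _).trans hN
  have hN1 : (1 : ℝ) ≤ N := (le_max_right _ _).trans hN
  have hN0 : (0 : ℝ) < N := by linarith
  have hmain := hC N hN₀ t₀ W hW hsep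
  set T : ℝ := (N : ℝ) ^ (6 / 5 : ℝ) with hT
  have hT1 : 1 ≤ T := Real.one_le_rpow hN1 (by norm_num)
  have hT0 : 0 ≤ T := by linarith
  have hNT : (N : ℝ) ≤ T := by
    calc (N : ℝ) = (N : ℝ) ^ (1 : ℝ) := (Real.rpow_one _).symm
      _ ≤ T := Real.rpow_le_rpow_of_exponent_le hN1 (by norm_num)
  set K : ℝ := (W.card : ℝ) with hK
  have hK0 : 0 ≤ K := Nat.cast_nonneg _
  set E : ℝ := GuthMaynardAssembly.addEnergy W with hE
  have hE0 : 0 ≤ E := addEnergy_nonneg W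
  have hKE : K ^ 2 ≤ E := GuthMaynardEnergyBound.card_sq_le_energy W
  have hK_le : K ≤ E ^ (1 / 2 : ℝ) := by
    calc K = (K ^ 2) ^ (1 / 2 : ℝ) := by rw [← Real.sqrt_eq_rpow, Real.sqrt_sq hK0]
      _ ≤ E ^ (1 / 2 : ℝ) := Real.rpow_le_rpow (sq_nonneg _) hKE (by norm_num)
  have h32 : K ^ (3 / 2 : ℝ) ≤ K ^ (1 / 2 : ℝ) * E ^ (1 / 2 : ℝ) := by
    calc K ^ (3 / 2 : ℝ) = K ^ (1 / 2 : ℝ) * K := by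
          rw [show (3 / 2 : ℝ) = 1 / 2 + 1 by norm_num, Real.rpow_add' hK0 (by norm_num),
            Real.rpow_one]
      _ ≤ K ^ (1 / 2 : ℝ) * E ^ (1 / 2 : ℝ) := by gcongr
  set X : ℝ := T ^ 2 * K ^ (1 / 2 : ℝ) * E ^ (1 / 2 : ℝ) with hX
  have hX0 : 0 ≤ X := by positivity
  have h1 : T ^ 2 * K ^ (3 / 2 : ℝ) ≤ X := by
    calc T ^ 2 * K ^ (3 / 2 : ℝ) ≤ T ^ 2 * (K ^ (1 / 2 : ℝ) * E ^ (1 / 2 : ℝ)) := by gcongr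
      _ = X := by rw [hX]; ring
  have h2 : T * N * K ^ (1 / 2 : ℝ) * E ^ (1 / 2 : ℝ) ≤ X := by
    have hTN : T * (N : ℝ) ≤ T ^ 2 := by rw [sq]; gcongr
    calc T * N * K ^ (1 / 2 : ℝ) * E ^ (1 / 2 : ℝ) = (T * N) * (K ^ (1 / 2 : ℝ) * E ^ (1 / 2 : ℝ)) := by
          ring
      _ ≤ T ^ 2 * (K ^ (1 / 2 : ℝ) * E ^ (1 / 2 : ℝ)) := by gcongr
      _ = X := by rw [hX]; ring
  have hsum0 : 0 ≤ T ^ 2 * K ^ (3 / 2 : ℝ) + T * N * K ^ (1 / 2 : ℝ) * E ^ (1 / 2 : ℝ) := by positivity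
  calc ‖S3 w N W‖ ≤ C * (N : ℝ) ^ δ * (T ^ 2 * K ^ (3 / 2 : ℝ) + T * N * K ^ (1 / 2 : ℝ) * E ^ (1 / 2 : ℝ)) :=
        hmain
    _ ≤ |C| * (N : ℝ) ^ δ * (T ^ 2 * K ^ (3 / 2 : ℝ) + T * N * K ^ (1 / 2 : ℝ) * E ^ (1 / 2 : ℝ)) :=
        mul_le_mul_of_nonneg_right (mul_le_mul_of_nonneg_right (le_abs_self C) (by positivity)) hsum0
    _ ≤ |C| * (N : ℝ) ^ δ * (X + X) := by gcongr
    _ = 2 * |C| * (N : ℝ) ^ δ * X := by ring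

/-! ## §3. Proof of Lemma 1.7 (§11 of the paper, "Proof of Lemma 1.7") -/

/-- The footnote to Theorem 1.6 as a pure inequality: `K^{5/4} n^{7/4} ≤ K²n + Kn²` for `K, n ≥ 0`
(weighted AM–GM, `K^{1/4}n^{3/4} ≤ K/4 + 3n/4 ≤ K + n`, times `Kn`).
[cite: GuthMaynard2026, footnote to Theorem 1.6 (arXiv v2 p. 4)] -/
private theorem rpow_five_fourths_mul_rpow_seven_fourths_le {K n : ℝ} (hK : 0 ≤ K) (hn : 0 ≤ n) :
    K ^ (5 / 4 : ℝ) * n ^ (7 / 4 : ℝ) ≤ K ^ 2 * n + K * n ^ 2 := by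
  have h := Real.geom_mean_le_arith_mean2_weighted (w₁ := 1 / 4) (w₂ := 3 / 4) (p₁ := K) (p₂ := n)
    (by norm_num) (by norm_num) hK hn (by norm_num)
  have h2 : K ^ (1 / 4 : ℝ) * n ^ (3 / 4 : ℝ) ≤ K + n := by
    refine h.trans ?_
    linarith
  have hK54 : K ^ (5 / 4 : ℝ) = K * K ^ (1 / 4 : ℝ) := by
    rw [show (5 / 4 : ℝ) = 1 + 1 / 4 by norm_num, Real.rpow_add' hK (by norm_num), Real.rpow_one]
  have hn74 : n ^ (7 / 4 : ℝ) = n * n ^ (3 / 4 : ℝ) := by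
    rw [show (7 / 4 : ℝ) = 1 + 3 / 4 by norm_num, Real.rpow_add' hn (by norm_num), Real.rpow_one]
  calc K ^ (5 / 4 : ℝ) * n ^ (7 / 4 : ℝ) = (K * n) * (K ^ (1 / 4 : ℝ) * n ^ (3 / 4 : ℝ)) := by
        rw [hK54, hn74]; ring
    _ ≤ (K * n) * (K + n) := mul_le_mul_of_nonneg_left h2 (mul_nonneg hK hn)
    _ = K ^ 2 * n + K * n ^ 2 := by ring

/-- **Guth–Maynard Lemma 1.7, proved** (discharge of `GuthMaynard2026_lemma_1_7`). The printed proof: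
`E(W) ≤ C₀ N^{-2σ} ∑_{n₁,n₂}|R(n₁/n₂)|³` (Lemma 11.4, `energy_le_third_moment_abs`, applied to `b`
extended by `b_N := 0` so that the half-open sum is the tree's closed one),
`|R|³ ≤ |W|·|R|²` (`norm_Rfun_le`), `∑_{n₁,n₂∈[N,2N]}|R(n₁/n₂)|² ≤ C₂T^{ε/2}(|W|²N + |W|N² +
|W|^{5/4}T^{1/2}N)` (Lemma 11.5 = Heath-Brown, `discrete_second_moment`), the footnote
`|W|^{5/4}T^{1/2}N ≤ |W|²N + |W|N²` for `T ≤ N^{3/2}`, and `T^{ε/2} ≤ N^{3ε/4} ≤ N^ε`.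
[cite: GuthMaynard2026, Lemma 1.7 (proof in §11; arXiv v2 p. 40)] -/
theorem GuthMaynard2026_lemma_1_7_holds : GuthMaynard2026_lemma_1_7 := by
  intro ε hε
  have hη : 0 < ε / 2 := by positivity
  obtain ⟨C₀, hC₀0, hC₀⟩ := energy_le_third_moment_abs
  obtain ⟨C₂, hC₂0, hC₂⟩ := discrete_second_moment hη
  refine ⟨2 * C₀ * C₂, 1, fun T hT N hNlo hNhi σ _hσ b W hb hW hsep hlarge ↦ ?_⟩
  classical
  -- positivity bookkeeping
  have hT0 : 0 < T := by linarith
  have hN1r : (1 : ℝ) ≤ N := by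
    calc (1 : ℝ) = 1 ^ (2 / 3 : ℝ) := (Real.one_rpow _).symm
      _ ≤ T ^ (2 / 3 : ℝ) := Real.rpow_le_rpow zero_le_one hT (by norm_num)
      _ ≤ N := hNlo
  have hN1 : 1 ≤ N := by exact_mod_cast hN1r
  have hN0 : (0 : ℝ) < N := by linarith
  set K : ℝ := (W.card : ℝ) with hK
  have hK0 : 0 ≤ K := Nat.cast_nonneg _
  set E₁ : ℝ := ((((W ×ˢ W) ×ˢ (W ×ˢ W)).filter
    (fun q : (ℝ × ℝ) × (ℝ × ℝ) ↦ |q.1.1 + q.1.2 - q.2.1 - q.2.2| ≤ 1)).card : ℝ) with hE₁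
  have hEdef : GuthMaynardAssembly.addEnergy W = E₁ := rfl
  rw [hEdef]
  -- the printed half-open sum `∑_{N<n≤2N}` is the tree's closed sum for `b` extended by `b_N = 0`
  set b' : ℕ → ℂ := fun n ↦ if n = N then 0 else b n with hb'
  have hb'1 : ∀ n, ‖b' n‖ ≤ 1 := fun n ↦ by
    simp only [hb']
    split_ifs
    · simp
    · exact hb n
  have hsum : ∀ t : ℝ, ∑ n ∈ Finset.Icc N (2 * N), b' n * (n : ℂ) ^ ((t : ℂ) * I) =
      ∑ n ∈ Finset.Ioc N (2 * N), b n * (n : ℂ) ^ ((t : ℂ) * I) := by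
    intro t
    have hIcc : Finset.Icc N (2 * N) = insert N (Finset.Ioc N (2 * N)) := by
      ext n
      simp only [Finset.mem_Icc, Finset.mem_insert, Finset.mem_Ioc]
      omega
    rw [hIcc, Finset.sum_insert (by simp)]
    simp only [hb', if_pos rfl, zero_mul, zero_add]
    refine Finset.sum_congr rfl fun n hn ↦ ?_
    rw [Finset.mem_Ioc] at hn
    rw [if_neg (by omega)]
  have hlarge' : ∀ t ∈ W, (N : ℝ) ^ σ ≤
      ‖∑ n ∈ Finset.Icc N (2 * N), b' n * (n : ℂ) ^ ((t : ℂ) * I)‖ :=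
    fun t ht ↦ by rw [hsum]; exact (hlarge t ht).le
  -- Step 1: Lemma 11.4
  set S := Finset.Icc N (2 * N) with hS
  set M₃ : ℝ := ∑ n₁ ∈ S, ∑ n₂ ∈ S, ‖Rfun W ((n₁ : ℝ) / n₂)‖ ^ 3 with hM₃
  set M₂ : ℝ := ∑ n₁ ∈ S, ∑ n₂ ∈ S, ‖Rfun W ((n₁ : ℝ) / n₂)‖ ^ 2 with hM₂
  have hM₂0 : 0 ≤ M₂ := by positivity
  have h114 : E₁ ≤ C₀ * (N : ℝ) ^ (-2 * σ) * M₃ := hC₀ N hN1 σ b' W hb'1 hsep hlarge'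
  -- Step 2: the trivial bound `|R(x)| ≤ |W|`
  have h32 : M₃ ≤ K * M₂ := by
    rw [hM₃, hM₂, Finset.mul_sum]
    refine Finset.sum_le_sum fun n₁ _ ↦ ?_
    rw [Finset.mul_sum]
    refine Finset.sum_le_sum fun n₂ _ ↦ ?_
    have h1 : ‖Rfun W ((n₁ : ℝ) / n₂)‖ ≤ K := norm_Rfun_le W _
    calc ‖Rfun W ((n₁ : ℝ) / n₂)‖ ^ 3
        = ‖Rfun W ((n₁ : ℝ) / n₂)‖ * ‖Rfun W ((n₁ : ℝ) / n₂)‖ ^ 2 := by ring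
      _ ≤ K * ‖Rfun W ((n₁ : ℝ) / n₂)‖ ^ 2 := by gcongr
  -- Step 3: Lemma 11.5 (Heath-Brown) with `M = N` on the interval `[0, T]`
  have hW' : ∀ t ∈ W, (0 : ℝ) ≤ t ∧ t ≤ 0 + T := fun t ht ↦ by simpa using hW t ht
  have h115 : M₂ ≤ C₂ * T ^ (ε / 2) * (K ^ 2 * N + K * (N : ℝ) ^ 2 +
      K ^ (5 / 4 : ℝ) * T ^ (1 / 2 : ℝ) * N) := hC₂ N T 0 W hN1 hT hW' hsep
  -- Step 4: the footnote to Theorem 1.6 (`T ≤ N^{3/2}`)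
  have hT32 : T ≤ (N : ℝ) ^ (3 / 2 : ℝ) := by
    have h := Real.rpow_le_rpow (Real.rpow_nonneg hT0.le _) hNlo (by norm_num : (0 : ℝ) ≤ 3 / 2)
    rwa [← Real.rpow_mul hT0.le, show (2 / 3 : ℝ) * (3 / 2) = 1 by norm_num, Real.rpow_one] at h
  have hThalf : T ^ (1 / 2 : ℝ) ≤ (N : ℝ) ^ (3 / 4 : ℝ) := by
    have h := Real.rpow_le_rpow hT0.le hT32 (by norm_num : (0 : ℝ) ≤ 1 / 2)
    rwa [← Real.rpow_mul hN0.le, show (3 / 2 : ℝ) * (1 / 2) = 3 / 4 by norm_num] at h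
  have hfoot : K ^ (5 / 4 : ℝ) * T ^ (1 / 2 : ℝ) * N ≤ K ^ 2 * N + K * (N : ℝ) ^ 2 := by
    calc K ^ (5 / 4 : ℝ) * T ^ (1 / 2 : ℝ) * N ≤ K ^ (5 / 4 : ℝ) * (N : ℝ) ^ (3 / 4 : ℝ) * N := by
          gcongr
      _ = K ^ (5 / 4 : ℝ) * (N : ℝ) ^ (7 / 4 : ℝ) := by
          rw [mul_assoc, ← Real.rpow_add_one hN0.ne' (3 / 4 : ℝ)]
          norm_num
      _ ≤ K ^ 2 * N + K * (N : ℝ) ^ 2 := rpow_five_fourths_mul_rpow_seven_fourths_le hK0 hN0.le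
  have hM₂le : M₂ ≤ 2 * C₂ * T ^ (ε / 2) * (K ^ 2 * N + K * (N : ℝ) ^ 2) := by
    calc M₂ ≤ C₂ * T ^ (ε / 2) * (K ^ 2 * N + K * (N : ℝ) ^ 2 +
          K ^ (5 / 4 : ℝ) * T ^ (1 / 2 : ℝ) * N) := h115
      _ ≤ C₂ * T ^ (ε / 2) * (K ^ 2 * N + K * (N : ℝ) ^ 2 + (K ^ 2 * N + K * (N : ℝ) ^ 2)) := by
          gcongr
      _ = 2 * C₂ * T ^ (ε / 2) * (K ^ 2 * N + K * (N : ℝ) ^ 2) := by ring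
  -- Step 5: `T^{ε/2} ≤ N^{3ε/4} ≤ N^ε`
  have hTε : T ^ (ε / 2) ≤ (N : ℝ) ^ ε := by
    calc T ^ (ε / 2) ≤ ((N : ℝ) ^ (3 / 2 : ℝ)) ^ (ε / 2) := Real.rpow_le_rpow hT0.le hT32 hη.le
      _ = (N : ℝ) ^ (3 / 2 * (ε / 2)) := by rw [← Real.rpow_mul hN0.le]
      _ ≤ (N : ℝ) ^ ε := Real.rpow_le_rpow_of_exponent_le hN1r (by linarith)
  -- assembly
  have hpow1 : (N : ℝ) ^ (-2 * σ) * (N : ℝ) ^ ε * N = (N : ℝ) ^ (1 - 2 * σ + ε) := by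
    rw [← Real.rpow_add hN0, ← Real.rpow_add_one hN0.ne']
    congr 1
    ring
  have hpow2 : (N : ℝ) ^ (-2 * σ) * (N : ℝ) ^ ε * (N : ℝ) ^ 2 = (N : ℝ) ^ (2 - 2 * σ + ε) := by
    rw [← Real.rpow_add hN0, ← Real.rpow_natCast (N : ℝ) 2, ← Real.rpow_add hN0]
    congr 1
    push_cast
    ring
  calc E₁ ≤ C₀ * (N : ℝ) ^ (-2 * σ) * M₃ := h114
    _ ≤ C₀ * (N : ℝ) ^ (-2 * σ) * (K * M₂) := by gcongr
    _ ≤ C₀ * (N : ℝ) ^ (-2 * σ) * (K * (2 * C₂ * T ^ (ε / 2) * (K ^ 2 * N + K * (N : ℝ) ^ 2))) := by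
        gcongr
    _ ≤ C₀ * (N : ℝ) ^ (-2 * σ) * (K * (2 * C₂ * (N : ℝ) ^ ε * (K ^ 2 * N + K * (N : ℝ) ^ 2))) := by
        gcongr
    _ = 2 * C₀ * C₂ * (K ^ 3 * ((N : ℝ) ^ (-2 * σ) * (N : ℝ) ^ ε * N) +
          K ^ 2 * ((N : ℝ) ^ (-2 * σ) * (N : ℝ) ^ ε * (N : ℝ) ^ 2)) := by ring
    _ = 2 * C₀ * C₂ * (K ^ 3 * (N : ℝ) ^ (1 - 2 * σ + ε) + K ^ 2 * (N : ℝ) ^ (2 - 2 * σ + ε)) := by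
        rw [hpow1, hpow2]

end Literature.NumberTheory.LFunctions

end
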